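import Literature.Topology.CoveringSpaces.ExteriorDiscCovering
import Literature.Topology.CoveringSpaces.PunctureFill
import Mathlib.Topology.Compactification.OnePoint.Basic
import Mathlib.Topology.Maps.Proper.Basic
import Mathlib.Analysis.Normed.Group.Bounded
import Mathlib.Analysis.SpecialFunctions.Pow.Asymptotics
import HarnessLib

/-!
# The ends of a finite branched covering of the plane and their compactification (topology)

Layer `Literature/Geometry/Kaehler`. O. Forster, *Lectures on Riemann Surfaces*, GTM 81 (1981),
§8, Thm. 8.4: a proper holomorphic map `F : X → ℂ` with finite fibres from a Riemann surface,
unbranched over `{R < |z|}`, extends to a proper map `X̄ → ℙ¹(ℂ)` of a compact Riemann surface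
`X̄ = X ∪ {one point for each end}`, the ends being the connected components of `F⁻¹{R < |z|}`,
each a punctured disc `w ↦ w^e` at infinity (Thm. 5.10, the tree's
`Literature.Topology.CoveringSpaces.exists_homeomorph_pow_eq`). This file does the TOPOLOGY (the
complex structure is `RiemannSurfaceEndsComplex`):

* `EndsDatum T` — a continuous proper `F : T → ℂ` with finite fibres on a Hausdorff space, a
  local homeomorphism over `{R < |z|}` (`R > 0`); `EndsDatum.End` — the ends (components of
  `F⁻¹{R < |z|}`), FINITELY many (`Finite D.End`), each open, projecting onto `{R < |z|}`, with
  its `ExteriorCoveringDatum` (`End.datum`: degree `e_K`, root `w_K`, `w_K ^ e_K = F`);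
* `EndsDatum.Cpt` — **the compactification** `T ⊔ {∞_K}` (the tree's `PunctureFill` of
  `T → ℂ ⊂ ℂ ∪ {∞}` at `∞`, one new point per end), `inl : T → Cpt` an open embedding with
  cofinite range, `atEnd K` — the filter «`|F| → ∞` inside `K`» governing continuity at `∞_K`
  (`continuousAt_infty_iff`);
* `EndsDatum.Cpt` is HAUSDORFF (`instT2Space`);
* `endChart K` — **the chart `ζ_K` at `∞_K`**: `ζ_K(∞_K) = 0`, `ζ_K(k) = w_K(k)⁻¹` on `K`, an
  `OpenPartialHomeomorph` from `{∞_K} ∪ K` onto the disc of radius `R^{-1/e_K}`, with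
  `|ζ_K|^{e_K} = |F|⁻¹` (`norm_endChart_pow`);
* `EndsDatum.Cpt` is COMPACT (`instCompactSpace`: the preimage of a closed disc under the proper
  `F` together with the closed cusp discs `ζ_K⁻¹{|ζ| ≤ ρ}`).

Everything is proved; the definitions are the data, the ends, the compactification, its maps
and the end charts.

## References

* O. Forster, *Lectures on Riemann Surfaces*, GTM 81, Springer (1981), §8 Thm. 8.4, §5 Thm. 5.10.
  [Forster1981]
-/

noncomputable section

open Set Filter Topology Function Complex Bornology
open Literature.Topology.CoveringSpaces

namespace Literature.Geometry.Kaehler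

namespace RiemannSurface

/-! ### The datum -/

/-- **A finite branched covering of the plane, unbranched at infinity.** A continuous proper map
`F : T → ℂ` with finite fibres which is a covering map over the exterior `{R < |z|}` of a disc
(`R > 0`); on a Hausdorff space the last condition follows from `F` being a local homeomorphism
there (`EndsDatum.ofLocHomeo`). [cite: Forster1981, §8 Thm. 8.4] -/
structure EndsDatum (T : Type*) [TopologicalSpace T] where
  /-- the projection -/
  F : T → ℂ
  /-- the radius beyond which `F` is unbranched -/
  R : ℝ
  /-- the radius is positive -/
  R_pos : 0 < R
  /-- `F` is continuous -/
  continuous : Continuous F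
  /-- `F` is proper -/
  proper : IsProperMap F
  /-- the fibres are finite -/
  finite_fibre : ∀ z, (F ⁻¹' {z}).Finite
  /-- `F` is a covering map over the exterior of the disc -/
  cov : IsCoveringMapOn F (extDisc R)

namespace EndsDatum

/-- **Constructor from a local homeomorphism over the exterior** on a Hausdorff space: a closed
local homeomorphism with finite fibres is a covering map (Mathlib's
`IsClosedMap.isCoveringMapOn_of_isLocalHomeomorphOn`). [cite: Forster1981, §4 Thm. 4.22] -/
def ofLocHomeo {T : Type*} [TopologicalSpace T] [T2Space T] (F : T → ℂ) (R : ℝ) (hR : 0 < R)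
    (hc : Continuous F) (hp : IsProperMap F) (hfin : ∀ z, (F ⁻¹' {z}).Finite)
    (hloc : IsLocalHomeomorphOn F (F ⁻¹' extDisc R)) : EndsDatum T :=
  ⟨F, R, hR, hc, hp, hfin, hp.isClosedMap.isCoveringMapOn_of_isLocalHomeomorphOn (fun z _ ↦ hfin z) hloc⟩

/-- The projection of `ofLocHomeo` (definitional). [folklore] -/
@[simp] theorem ofLocHomeo_F {T : Type*} [TopologicalSpace T] [T2Space T] (F : T → ℂ) (R : ℝ) (hR : 0 < R)
    (hc : Continuous F) (hp : IsProperMap F) (hfin : ∀ z, (F ⁻¹' {z}).Finite)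
    (hloc : IsLocalHomeomorphOn F (F ⁻¹' extDisc R)) : (ofLocHomeo F R hR hc hp hfin hloc).F = F := rfl

/-- The radius of `ofLocHomeo` (definitional). [folklore] -/
@[simp] theorem ofLocHomeo_R {T : Type*} [TopologicalSpace T] [T2Space T] (F : T → ℂ) (R : ℝ) (hR : 0 < R)
    (hc : Continuous F) (hp : IsProperMap F) (hfin : ∀ z, (F ⁻¹' {z}).Finite)
    (hloc : IsLocalHomeomorphOn F (F ⁻¹' extDisc R)) : (ofLocHomeo F R hR hc hp hfin hloc).R = R := rfl

variable {T : Type*} [TopologicalSpace T] (D : EndsDatum T)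

/-- The total space over the exterior, `F⁻¹{R < |z|}`. [folklore] -/
def total : Set T := D.F ⁻¹' extDisc D.R

/-- Membership in the total space (definitional). [folklore] -/
@[simp] theorem mem_total {t : T} : t ∈ D.total ↔ D.R < ‖D.F t‖ := Iff.rfl

/-- `F` is a closed map. [folklore] -/
theorem isClosedMap : IsClosedMap D.F := D.proper.isClosedMap

/-! ### The ends -/

/-- **The ends**: the connected components of `F⁻¹{R < |z|}`. [cite: Forster1981, §8 Thm. 8.4 (proof)] -/
def End : Type _ := {K : Set T // ∃ k ∈ D.total, K = connectedComponentIn D.total k}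

variable {D}

namespace End

/-- An end as a subset of `T`. [folklore] -/
instance instCoeSet : CoeOut D.End (Set T) := ⟨Subtype.val⟩

/-- Ends are determined by their carriers. [folklore] -/
theorem ext {K K' : D.End} (h : (K : Set T) = K') : K = K' := Subtype.ext h

/-- A chosen base point of an end. [folklore] -/
def pt (K : D.End) : T := K.2.choose

/-- The base point lies in the total space. [folklore] -/
theorem pt_mem_total (K : D.End) : K.pt ∈ D.total := K.2.choose_spec.1

/-- The end is the component of its base point. [folklore] -/
theorem eq_component (K : D.End) : (K : Set T) = connectedComponentIn D.total K.pt := K.2.choose_spec.2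

/-- The base point lies in the end. [folklore] -/
theorem pt_mem (K : D.End) : K.pt ∈ (K : Set T) := by
  rw [K.eq_component]
  exact mem_connectedComponentIn K.pt_mem_total

/-- An end lies in the total space. [folklore] -/
theorem subset_total (K : D.End) : (K : Set T) ⊆ D.total := by
  rw [K.eq_component]
  exact connectedComponentIn_subset _ _

/-- An end is the component of each of its points. [folklore] -/
theorem eq_component_of_mem (K : D.End) {k : T} (hk : k ∈ (K : Set T)) :
    (K : Set T) = connectedComponentIn D.total k := by
  rw [K.eq_component] at hk ⊢
  exact connectedComponentIn_eq hk

/-- **Two ends sharing a point are equal.** [folklore] -/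
theorem eq_of_mem {K K' : D.End} {k : T} (hk : k ∈ (K : Set T)) (hk' : k ∈ (K' : Set T)) : K = K' :=
  ext ((K.eq_component_of_mem hk).trans (K'.eq_component_of_mem hk').symm)

/-- Distinct ends are disjoint. [folklore] -/
theorem disjoint_of_ne {K K' : D.End} (h : K ≠ K') : Disjoint (K : Set T) K' :=
  disjoint_left.2 fun _ hk hk' ↦ h (eq_of_mem hk hk')

/-- **The exterior covering datum of an end** (`ExteriorDiscCovering`), based at its base point.
[cite: Forster1981, §5 Thm. 5.10] -/
def datum (K : D.End) : ExteriorCoveringDatum T :=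
  ⟨D.F, D.R, D.R_pos, D.cov, K.pt, K.pt_mem_total, D.finite_fibre _⟩

/-- The projection of the datum (definitional). [folklore] -/
@[simp] theorem datum_p (K : D.End) : K.datum.p = D.F := rfl

/-- The radius of the datum (definitional). [folklore] -/
@[simp] theorem datum_R (K : D.End) : K.datum.R = D.R := rfl

/-- The component of the datum is the end. [folklore] -/
theorem datum_component (K : D.End) : K.datum.component = (K : Set T) := K.eq_component.symm

/-- **Ends are open.** [cite: Forster1981, §5 Thm. 5.10] -/
theorem isOpen (K : D.End) : IsOpen (K : Set T) := by
  rw [← datum_component]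
  exact K.datum.isOpen_component

/-- **Ends project onto the exterior of the disc.** [cite: Forster1981, §5 Thm. 5.10] -/
theorem image_eq (K : D.End) : D.F '' (K : Set T) = extDisc D.R := by
  rw [← datum_component]
  exact K.datum.image_component

/-- **The degree `e_K ≥ 1` of an end.** [cite: Forster1981, §5 Thm. 5.10] -/
def degree (K : D.End) : ℕ := K.datum.degree

/-- The degree is positive. [folklore] -/
theorem degree_pos (K : D.End) : 0 < K.degree := K.datum.degree_pos

/-- The degree as a real number is positive. [folklore] -/
theorem degree_pos_real (K : D.End) : 0 < (K.degree : ℝ) := Nat.cast_pos.2 K.degree_pos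

/-- **The root `w_K : K ≃ {R^{1/e_K} < |w|}` with `w_K ^ e_K = F`.** [cite: Forster1981, §5 Thm. 5.10] -/
def root (K : D.End) : (K : Set T) ≃ₜ extDisc (D.R ^ (1 / (K.degree : ℝ))) :=
  (Homeomorph.setCongr K.datum_component.symm).trans K.datum.rootHomeomorph

/-- `w_K ^ e_K = F`. [cite: Forster1981, §5 Thm. 5.10] -/
theorem root_pow (K : D.End) (k : (K : Set T)) : (K.root k : ℂ) ^ K.degree = D.F k :=
  K.datum.rootHomeomorph_pow ⟨k, by rw [datum_component]; exact k.2⟩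

/-- `|w_K| ^ e_K = |F|`. [folklore] -/
theorem norm_root_pow (K : D.End) (k : (K : Set T)) : ‖(K.root k : ℂ)‖ ^ K.degree = ‖D.F k‖ := by
  rw [← norm_pow, root_pow]

/-- The root does not vanish. [folklore] -/
theorem root_ne_zero (K : D.End) (k : (K : Set T)) : (K.root k : ℂ) ≠ 0 :=
  ne_zero_of_mem_extDisc (Real.rpow_pos_of_pos D.R_pos _) (K.root k).2

/-- `|w_K| = |F| ^ {1/e_K}`. [folklore] -/
theorem norm_root (K : D.End) (k : (K : Set T)) : ‖(K.root k : ℂ)‖ = ‖D.F k‖ ^ (1 / (K.degree : ℝ)) := by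
  have h := K.norm_root_pow k
  set x := ‖(K.root k : ℂ)‖ with hx
  rw [← h, one_div, Real.pow_rpow_inv_natCast (norm_nonneg _) K.degree_pos.ne']

end End

variable (D)

/-- The end through a point of the total space. [folklore] -/
def endOf {k : T} (hk : k ∈ D.total) : D.End := ⟨connectedComponentIn D.total k, k, hk, rfl⟩

/-- A point of the total space lies in its end. [folklore] -/
theorem mem_endOf {k : T} (hk : k ∈ D.total) : k ∈ (D.endOf hk : Set T) := mem_connectedComponentIn hk

/-- **There are finitely many ends** (each meets the finite fibre over `R + 1`). [cite: Forster1981, §8 Thm. 8.4 (proof)] -/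
instance instFiniteEnd : Finite D.End := by
  set a : ℂ := ((D.R + 1 : ℝ) : ℂ) with ha
  have hamem : a ∈ extDisc D.R := by
    rw [mem_extDisc, ha, Complex.norm_real, Real.norm_eq_abs, abs_of_pos (by linarith [D.R_pos])]
    linarith
  have hex : ∀ K : D.End, ∃ k ∈ (K : Set T), D.F k = a := fun K ↦ by
    have h : a ∈ D.F '' (K : Set T) := by rw [K.image_eq]; exact hamem
    obtain ⟨k, hk, hka⟩ := h
    exact ⟨k, hk, hka⟩
  choose k hk hka using hex
  haveI : Finite (D.F ⁻¹' {a}) := (D.finite_fibre a).to_subtype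
  refine Finite.of_injective (fun K ↦ (⟨k K, hka K⟩ : D.F ⁻¹' {a})) fun K K' h ↦ ?_
  have e : k K = k K' := congr_arg Subtype.val h
  exact End.eq_of_mem (hk K) (e ▸ hk K')

/-- A `Fintype` structure on the ends. [folklore] -/
instance instFintypeEnd : Fintype D.End := Fintype.ofFinite _

/-! ### The compactification `T ⊔ {∞_K}` -/

/-- `F` followed by the inclusion `ℂ ⊂ ℂ ∪ {∞}`. [folklore] -/
def projInfty : T → OnePoint ℂ := fun t ↦ (D.F t : OnePoint ℂ)

/-- `projInfty` is continuous. [folklore] -/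
theorem continuous_projInfty : Continuous D.projInfty := OnePoint.continuous_coe.comp D.continuous

/-- `projInfty` omits `∞`. [folklore] -/
theorem projInfty_ne (t : T) : D.projInfty t ≠ OnePoint.infty := OnePoint.coe_ne_infty _

/-- The carriers of the ends, as the family of sheets to be filled. [folklore] -/
def sheet : D.End → Set T := fun K ↦ (K : Set T)

/-- The sheets are open. [folklore] -/
theorem isOpen_sheet (K : D.End) : IsOpen (D.sheet K) := K.isOpen

/-- **The compactification** `T̄ = T ⊔ {∞_K | K an end}` with the cusp topology at the new points
(the tree's `PunctureFill` of `T → ℂ ∪ {∞}` at `∞`). [cite: Forster1981, §8 Thm. 8.4] -/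
abbrev Cpt : Type _ := PunctureFill D.projInfty OnePoint.infty D.sheet

/-- The old points. [folklore] -/
def inl : T → D.Cpt := PunctureFill.inl D.projInfty OnePoint.infty D.sheet

/-- The new points `∞_K`. [folklore] -/
def infty (K : D.End) : D.Cpt := PunctureFill.inr D.projInfty OnePoint.infty D.sheet K

/-- `inl` is injective. [folklore] -/
theorem inl_injective : Injective D.inl := PunctureFill.inl_injective _ _ _

/-- `infty` is injective. [folklore] -/
theorem infty_injective : Injective D.infty := PunctureFill.inr_injective _ _ _

/-- Old and new points differ. [folklore] -/
theorem inl_ne_infty (t : T) (K : D.End) : D.inl t ≠ D.infty K := PunctureFill.inl_ne_inr _ _ _ t K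

/-- Every point is old or new. [folklore] -/
theorem inl_or_infty (x : D.Cpt) : (∃ t, x = D.inl t) ∨ ∃ K, x = D.infty K := PunctureFill.inl_or_inr _ _ _ x

/-- **`inl` is an open embedding.** [folklore] -/
theorem isOpenEmbedding_inl : IsOpenEmbedding D.inl :=
  PunctureFill.isOpenEmbedding_inl D.continuous_projInfty D.isOpen_sheet

/-- `inl` is continuous. [folklore] -/
theorem continuous_inl : Continuous D.inl := D.isOpenEmbedding_inl.continuous

/-- The range of `inl` is open. [folklore] -/
theorem isOpen_range_inl : IsOpen (range D.inl) := D.isOpenEmbedding_inl.isOpen_range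

/-- The complement of the range of `inl` is the finite set of new points. [folklore] -/
theorem compl_range_inl : (range D.inl)ᶜ = range D.infty := by
  ext x
  rcases D.inl_or_infty x with ⟨t, rfl⟩ | ⟨K, rfl⟩
  · simp only [mem_compl_iff, mem_range_self, not_true_eq_false, mem_range, false_iff, not_exists]
    exact fun K h ↦ D.inl_ne_infty t K h.symm
  · simp only [mem_compl_iff, mem_range, not_exists, exists_apply_eq_apply, iff_true]
    exact fun t h ↦ D.inl_ne_infty t K h

/-! ### The filter of an end and continuity at the new points -/

/-- **The filter «`|F| → ∞` inside the end `K`».** [folklore] -/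
def atEnd (K : D.End) : Filter T := comap D.F (comap norm atTop) ⊓ 𝓟 (K : Set T)

/-- The filter of neighbourhoods of `∞` pulled back by `projInfty` is «`|F| → ∞`». [folklore] -/
theorem comap_projInfty_nhds_infty : comap D.projInfty (𝓝 OnePoint.infty) = comap D.F (comap norm atTop) := by
  rw [show D.projInfty = ((↑) : ℂ → OnePoint ℂ) ∘ D.F from rfl, ← comap_comap, OnePoint.comap_coe_nhds_infty, coclosedCompact_eq_cocompact, comap_norm_atTop,
    Metric.cobounded_eq_cocompact]

/-- **Continuity at `∞_K`**: a map `g` out of the compactification is continuous at `∞_K` iff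
`g ∘ inl → g(∞_K)` along `atEnd K`. [folklore] -/
theorem continuousAt_infty_iff {Y : Type*} [TopologicalSpace Y] {g : D.Cpt → Y} (K : D.End) :
    ContinuousAt g (D.infty K) ↔ Tendsto (fun t ↦ g (D.inl t)) (D.atEnd K) (𝓝 (g (D.infty K))) := by
  rw [infty, PunctureFill.continuousAt_inr_iff D.continuous_projInfty D.isOpen_sheet, comap_projInfty_nhds_infty]
  rfl

/-- `|F| → ∞` along `atEnd K`. [folklore] -/
theorem tendsto_norm_atEnd (K : D.End) : Tendsto (fun t ↦ ‖D.F t‖) (D.atEnd K) atTop :=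
  (tendsto_comap.comp tendsto_comap).mono_left inf_le_left

/-- Points are eventually in `K` along `atEnd K`. [folklore] -/
theorem eventually_mem_atEnd (K : D.End) : ∀ᶠ t in D.atEnd K, t ∈ (K : Set T) :=
  mem_inf_of_right (mem_principal_self _)

/-- A basis of `atEnd K`: the sets `K ∩ {r < |F|}`. [folklore] -/
theorem atEnd_hasBasis (K : D.End) :
    (D.atEnd K).HasBasis (fun _ : ℝ ↦ True) fun r ↦ (K : Set T) ∩ D.F ⁻¹' extDisc r := by
  have h := ((atTop_basis_Ioi.comap norm).comap D.F).inf_principal (K : Set T)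
  refine h.to_hasBasis (fun r _ ↦ ⟨r, trivial, fun t ht ↦ ⟨ht.2, ht.1⟩⟩) fun r _ ↦ ⟨r, trivial, fun t ht ↦ ⟨ht.2, ht.1⟩⟩

/-- **The cusp neighbourhoods** `{∞_K} ∪ (K ∩ {r < |F|})`. [folklore] -/
def cuspNhd (K : D.End) (r : ℝ) : Set D.Cpt := insert (D.infty K) (D.inl '' ((K : Set T) ∩ D.F ⁻¹' extDisc r))

/-- The complement of the exterior of a disc is the closed disc. [folklore] -/
theorem compl_extDisc (r : ℝ) : (extDisc r)ᶜ = Metric.closedBall (0 : ℂ) r := by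
  ext z
  simp [extDisc, not_lt]

/-- The open set `{∞} ∪ {r < |z|}` of `ℂ ∪ {∞}`. [folklore] -/
theorem isOpen_inftyNhd (r : ℝ) : IsOpen (insert OnePoint.infty (((↑) : ℂ → OnePoint ℂ) '' extDisc r)) := by
  rw [OnePoint.isOpen_iff_of_mem (mem_insert _ _)]
  have hpre : ((↑) : ℂ → OnePoint ℂ) ⁻¹' insert OnePoint.infty (((↑) : ℂ → OnePoint ℂ) '' extDisc r) = extDisc r := by
    ext z
    simp only [mem_preimage, mem_insert_iff, OnePoint.coe_ne_infty, false_or, OnePoint.coe_injective.mem_set_image]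
  rw [hpre, compl_extDisc]
  exact ⟨Metric.isClosed_closedBall, isCompact_closedBall 0 r⟩

/-- The preimage of `{∞} ∪ {r < |z|}` under `projInfty` is `{r < |F|}`. [folklore] -/
theorem preimage_projInfty_inftyNhd (r : ℝ) :
    D.projInfty ⁻¹' insert OnePoint.infty (((↑) : ℂ → OnePoint ℂ) '' extDisc r) = D.F ⁻¹' extDisc r := by
  ext t
  simp only [projInfty, mem_preimage, mem_insert_iff, OnePoint.coe_ne_infty, false_or,
    OnePoint.coe_injective.mem_set_image]

/-- **Cusp neighbourhoods are open.** [folklore] -/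
theorem isOpen_cuspNhd (K : D.End) (r : ℝ) : IsOpen (D.cuspNhd K r) := by
  have h := PunctureFill.isOpen_cuspNhd (p := D.projInfty) (x₀ := OnePoint.infty) (U := D.sheet) K
    (isOpen_inftyNhd r) (mem_insert _ _)
  rwa [preimage_projInfty_inftyNhd] at h

/-- `∞_K` lies in its cusp neighbourhoods. [folklore] -/
theorem infty_mem_cuspNhd (K : D.End) (r : ℝ) : D.infty K ∈ D.cuspNhd K r := mem_insert _ _

/-- Membership of an old point in a cusp neighbourhood. [folklore] -/
theorem inl_mem_cuspNhd_iff {K : D.End} {r : ℝ} {t : T} : D.inl t ∈ D.cuspNhd K r ↔ t ∈ (K : Set T) ∧ r < ‖D.F t‖ := by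
  rw [cuspNhd, mem_insert_iff, D.inl_injective.mem_set_image]
  simp only [D.inl_ne_infty, false_or, mem_inter_iff, mem_preimage, mem_extDisc]

/-- A new point in a cusp neighbourhood is its centre. [folklore] -/
theorem infty_mem_cuspNhd_iff {K K' : D.End} {r : ℝ} : D.infty K' ∈ D.cuspNhd K r ↔ K' = K := by
  rw [cuspNhd, mem_insert_iff, D.infty_injective.eq_iff]
  simp only [mem_image, or_iff_left_iff_imp, forall_exists_index, and_imp]
  exact fun t _ h ↦ absurd h (D.inl_ne_infty t K')

/-- Cusp neighbourhoods are neighbourhoods of the new point. [folklore] -/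
theorem cuspNhd_mem_nhds (K : D.End) (r : ℝ) : D.cuspNhd K r ∈ 𝓝 (D.infty K) :=
  (D.isOpen_cuspNhd K r).mem_nhds (D.infty_mem_cuspNhd K r)

/-! ### The compactification is Hausdorff -/

/-- **`T̄` is Hausdorff** (for `T` Hausdorff). [cite: Forster1981, §8 Thm. 8.4 (proof)] -/
instance instT2Space [T2Space T] : T2Space D.Cpt := by
  refine (t2Space_iff _).2 fun x y hxy ↦ ?_
  rcases D.inl_or_infty x with ⟨t, rfl⟩ | ⟨K, rfl⟩ <;> rcases D.inl_or_infty y with ⟨t', rfl⟩ | ⟨K', rfl⟩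
  · -- two old points
    have htt' : t ≠ t' := fun h ↦ hxy (by rw [h])
    obtain ⟨u, v, hu, hv, htu, htv, huv⟩ := t2_separation htt'
    refine ⟨D.inl '' u, D.inl '' v, D.isOpenEmbedding_inl.isOpenMap u hu, D.isOpenEmbedding_inl.isOpenMap v hv,
      mem_image_of_mem _ htu, mem_image_of_mem _ htv, ?_⟩
    exact (disjoint_image_iff D.inl_injective).2 huv
  · -- old point, new point
    refine ⟨D.inl '' (D.F ⁻¹' Metric.ball (D.F t) 1), D.cuspNhd K' (‖D.F t‖ + 1),
      D.isOpenEmbedding_inl.isOpenMap _ (Metric.isOpen_ball.preimage D.continuous), D.isOpen_cuspNhd _ _,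
      mem_image_of_mem _ (by simp), D.infty_mem_cuspNhd _ _, disjoint_left.2 ?_⟩
    rintro _ ⟨s, hs, rfl⟩ hs'
    rw [inl_mem_cuspNhd_iff] at hs'
    rw [mem_preimage, Metric.mem_ball, dist_eq_norm] at hs
    linarith [norm_sub_norm_le (D.F s) (D.F t), hs'.2]
  · -- new point, old point
    refine ⟨D.cuspNhd K (‖D.F t'‖ + 1), D.inl '' (D.F ⁻¹' Metric.ball (D.F t') 1), D.isOpen_cuspNhd _ _,
      D.isOpenEmbedding_inl.isOpenMap _ (Metric.isOpen_ball.preimage D.continuous),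
      D.infty_mem_cuspNhd _ _, mem_image_of_mem _ (by simp), disjoint_left.2 ?_⟩
    rintro _ hs' ⟨s, hs, e⟩
    rw [← e, inl_mem_cuspNhd_iff] at hs'
    rw [mem_preimage, Metric.mem_ball, dist_eq_norm] at hs
    linarith [norm_sub_norm_le (D.F s) (D.F t'), hs'.2]
  · -- two new points
    have hKK' : K ≠ K' := fun h ↦ hxy (by rw [h])
    refine ⟨D.cuspNhd K 0, D.cuspNhd K' 0, D.isOpen_cuspNhd _ _, D.isOpen_cuspNhd _ _, D.infty_mem_cuspNhd _ _,
      D.infty_mem_cuspNhd _ _, disjoint_left.2 fun z hz hz' ↦ ?_⟩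
    rcases D.inl_or_infty z with ⟨s, rfl⟩ | ⟨K'', rfl⟩
    · rw [inl_mem_cuspNhd_iff] at hz hz'
      exact hKK' (End.eq_of_mem hz.1 hz'.1)
    · rw [infty_mem_cuspNhd_iff] at hz hz'
      exact hKK' (hz.symm.trans hz')

/-! ### The neighbourhood basis of a new point -/

/-- **The cusp neighbourhoods form a basis of neighbourhoods of `∞_K`** (an open set of `ℂ ∪ {∞}`
containing `∞` contains `{∞} ∪ {r < |z|}` for some `r`, its complement being compact).
[folklore] -/
theorem nhds_infty_hasBasis (K : D.End) : (𝓝 (D.infty K)).HasBasis (fun _ : ℝ ↦ True) fun r ↦ D.cuspNhd K r := by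
  have hb := PunctureFill.nhds_inr_hasBasis (p := D.projInfty) (x₀ := OnePoint.infty) (U := D.sheet)
    D.continuous_projInfty D.isOpen_sheet K
  refine hb.to_hasBasis (fun O ⟨hO, hOinf⟩ ↦ ?_) fun r _ ↦
    ⟨insert OnePoint.infty (((↑) : ℂ → OnePoint ℂ) '' extDisc r), ⟨isOpen_inftyNhd r, mem_insert _ _⟩, by
      rw [preimage_projInfty_inftyNhd]; exact Subset.rfl⟩
  -- the complement of `O` in `ℂ` is compact, hence bounded
  obtain ⟨-, hcpt⟩ := (OnePoint.isOpen_iff_of_mem hOinf).1 hO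
  obtain ⟨r, hr⟩ := hcpt.isBounded.subset_closedBall (0 : ℂ)
  refine ⟨r, trivial, ?_⟩
  rintro x hx
  rcases D.inl_or_infty x with ⟨t, rfl⟩ | ⟨K', rfl⟩
  · rw [inl_mem_cuspNhd_iff] at hx
    refine mem_insert_of_mem _ ⟨t, ⟨hx.1, ?_⟩, rfl⟩
    rw [mem_preimage]
    by_contra hnot
    have h := hr hnot
    rw [Metric.mem_closedBall, dist_zero_right] at h
    exact absurd hx.2 (not_lt.2 h)
  · rw [infty_mem_cuspNhd_iff] at hx
    subst hx
    exact mem_insert _ _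

/-! ### The end charts `ζ_K` -/

namespace End

variable {D}

/-- **The radius `ρ_K = R^{-1/e_K}` of the chart disc at `∞_K`.** [folklore] -/
def rho (K : D.End) : ℝ := (D.R ^ (1 / (K.degree : ℝ)))⁻¹

/-- The inner radius `R^{1/e_K}` is positive. [folklore] -/
theorem rpow_pos (K : D.End) : 0 < D.R ^ (1 / (K.degree : ℝ)) := Real.rpow_pos_of_pos D.R_pos _

/-- The chart radius is positive. [folklore] -/
theorem rho_pos (K : D.End) : 0 < K.rho := inv_pos.2 K.rpow_pos

/-- `|w_K| > R^{1/e_K}` on the end. [folklore] -/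
theorem lt_norm_root (K : D.End) (k : (K : Set T)) : D.R ^ (1 / (K.degree : ℝ)) < ‖(K.root k : ℂ)‖ := (K.root k).2

/-- `|w_K⁻¹| < ρ_K` on the end. [folklore] -/
theorem norm_root_inv_lt (K : D.End) (k : (K : Set T)) : ‖(K.root k : ℂ)⁻¹‖ < K.rho := by
  rw [norm_inv, rho]
  exact (inv_lt_inv₀ (K.rpow_pos.trans (K.lt_norm_root k)) K.rpow_pos).2 (K.lt_norm_root k)

/-- For `0 < |z| < ρ_K`, `z⁻¹` lies in the exterior `{R^{1/e_K} < |w|}`. [folklore] -/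
theorem inv_mem_extDisc (K : D.End) {z : ℂ} (hz : z ≠ 0) (hzρ : ‖z‖ < K.rho) :
    z⁻¹ ∈ extDisc (D.R ^ (1 / (K.degree : ℝ))) := by
  rw [mem_extDisc, norm_inv]
  rw [rho] at hzρ
  rwa [lt_inv_comm₀ K.rpow_pos (norm_pos_iff.2 hz)]

end End

open Classical in
/-- The end coordinate on the old points: `w_K⁻¹` on `K`, junk `0` elsewhere. [folklore] -/
def endCoordT (K : D.End) : T → ℂ := fun t ↦ if h : t ∈ (K : Set T) then ((K.root ⟨t, h⟩ : ℂ))⁻¹ else 0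

/-- The end coordinate on the end. [folklore] -/
theorem endCoordT_of_mem (K : D.End) {t : T} (ht : t ∈ (K : Set T)) : D.endCoordT K t = ((K.root ⟨t, ht⟩ : ℂ))⁻¹ := by
  classical
  exact dif_pos ht

/-- **The end coordinate `ζ_K`** on `T̄`: `w_K⁻¹` on `K`, `0` at the new points (junk off
`{∞_K} ∪ K`). [cite: Forster1981, §8 Thm. 8.4 (proof)] -/
def endCoord (K : D.End) : D.Cpt → ℂ := Sum.elim (D.endCoordT K) fun _ ↦ 0

/-- The end coordinate at an old point. [folklore] -/
@[simp] theorem endCoord_inl (K : D.End) (t : T) : D.endCoord K (D.inl t) = D.endCoordT K t := rfl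

/-- The end coordinate at a new point. [folklore] -/
@[simp] theorem endCoord_infty (K K' : D.End) : D.endCoord K (D.infty K') = 0 := rfl

/-- The end coordinate at a point of the end. [folklore] -/
theorem endCoord_inl_of_mem (K : D.End) {t : T} (ht : t ∈ (K : Set T)) :
    D.endCoord K (D.inl t) = ((K.root ⟨t, ht⟩ : ℂ))⁻¹ := by
  rw [endCoord_inl, endCoordT_of_mem _ _ ht]

/-- **`|ζ_K| = |F|^{-1/e_K}` on the end.** [cite: Forster1981, §8 Thm. 8.4 (proof)] -/
theorem norm_endCoord_inl (K : D.End) {t : T} (ht : t ∈ (K : Set T)) :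
    ‖D.endCoord K (D.inl t)‖ = ‖D.F t‖ ^ (-(1 / (K.degree : ℝ))) := by
  rw [endCoord_inl_of_mem _ _ ht, norm_inv, K.norm_root ⟨t, ht⟩, Real.rpow_neg (norm_nonneg _)]

/-- **`|ζ_K| ^ e_K = |F|⁻¹` on the end.** [cite: Forster1981, §8 Thm. 8.4 (proof)] -/
theorem norm_endCoord_inl_pow (K : D.End) {t : T} (ht : t ∈ (K : Set T)) :
    ‖D.endCoord K (D.inl t)‖ ^ K.degree = ‖D.F t‖⁻¹ := by
  rw [endCoord_inl_of_mem _ _ ht, norm_inv, inv_pow, K.norm_root_pow ⟨t, ht⟩]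

/-- The end coordinate does not vanish on the end. [folklore] -/
theorem endCoord_inl_ne_zero (K : D.End) {t : T} (ht : t ∈ (K : Set T)) : D.endCoord K (D.inl t) ≠ 0 := by
  rw [endCoord_inl_of_mem _ _ ht]
  exact inv_ne_zero (K.root_ne_zero _)

open Classical in
/-- **The inverse of the end coordinate**: `0 ↦ ∞_K`, `z ↦ w_K⁻¹(z⁻¹)` for `0 < |z| < ρ_K` (junk
`∞_K` elsewhere). [cite: Forster1981, §8 Thm. 8.4 (proof)] -/
def endCoordInv (K : D.End) : ℂ → D.Cpt := fun z ↦
  if z = 0 then D.infty K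
  else if h : z⁻¹ ∈ extDisc (D.R ^ (1 / (K.degree : ℝ))) then D.inl (K.root.symm ⟨z⁻¹, h⟩ : (K : Set T)) else D.infty K

/-- The inverse end coordinate at `0`. [folklore] -/
@[simp] theorem endCoordInv_zero (K : D.End) : D.endCoordInv K 0 = D.infty K := by
  classical
  exact if_pos rfl

/-- The inverse end coordinate off `0` inside the chart disc. [folklore] -/
theorem endCoordInv_of_ne (K : D.End) {z : ℂ} (hz : z ≠ 0) (hzρ : ‖z‖ < K.rho) :
    D.endCoordInv K z = D.inl (K.root.symm ⟨z⁻¹, K.inv_mem_extDisc hz hzρ⟩ : (K : Set T)) := by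
  classical
  unfold endCoordInv
  rw [if_neg hz, dif_pos (K.inv_mem_extDisc hz hzρ)]

/-- `ζ_K (ζ_K⁻¹ z) = z` in the chart disc. [folklore] -/
theorem endCoord_endCoordInv (K : D.End) {z : ℂ} (hzρ : ‖z‖ < K.rho) : D.endCoord K (D.endCoordInv K z) = z := by
  by_cases hz : z = 0
  · rw [hz, endCoordInv_zero, endCoord_infty]
  · rw [D.endCoordInv_of_ne K hz hzρ, D.endCoord_inl_of_mem K (K.root.symm _).2]
    simp only [Subtype.coe_eta, Homeomorph.apply_symm_apply, inv_inv]

/-- `ζ_K⁻¹ (ζ_K (inl t)) = inl t` on the end. [folklore] -/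
theorem endCoordInv_endCoord_inl (K : D.End) {t : T} (ht : t ∈ (K : Set T)) :
    D.endCoordInv K (D.endCoord K (D.inl t)) = D.inl t := by
  have hz : D.endCoord K (D.inl t) ≠ 0 := D.endCoord_inl_ne_zero K ht
  have hzρ : ‖D.endCoord K (D.inl t)‖ < K.rho := by
    rw [D.endCoord_inl_of_mem K ht]; exact K.norm_root_inv_lt _
  rw [D.endCoordInv_of_ne K hz hzρ]
  congr 1
  have e : (⟨(D.endCoord K (D.inl t))⁻¹, K.inv_mem_extDisc hz hzρ⟩ : extDisc (D.R ^ (1 / (K.degree : ℝ)))) =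
      K.root ⟨t, ht⟩ := Subtype.ext (by simp only [D.endCoord_inl_of_mem K ht, inv_inv])
  rw [e, Homeomorph.symm_apply_apply]

/-- **The end coordinate tends to `0` at `∞_K`** (`|ζ_K| = |F|^{-1/e_K} → 0`).
[cite: Forster1981, §8 Thm. 8.4 (proof)] -/
theorem tendsto_endCoordT_atEnd (K : D.End) : Tendsto (D.endCoordT K) (D.atEnd K) (𝓝 0) := by
  rw [tendsto_zero_iff_norm_tendsto_zero]
  have h : Tendsto (fun t ↦ ‖D.F t‖ ^ (-(1 / (K.degree : ℝ)))) (D.atEnd K) (𝓝 0) :=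
    (tendsto_rpow_neg_atTop (one_div_pos.2 K.degree_pos_real)).comp (D.tendsto_norm_atEnd K)
  refine h.congr' ?_
  filter_upwards [D.eventually_mem_atEnd K] with t ht
  rw [← D.norm_endCoord_inl K ht, endCoord_inl]

/-- The end coordinate is continuous at `∞_K`. [folklore] -/
theorem continuousAt_endCoord_infty (K : D.End) : ContinuousAt (D.endCoord K) (D.infty K) := by
  rw [continuousAt_infty_iff]
  simpa only [endCoord_inl, endCoord_infty] using D.tendsto_endCoordT_atEnd K

/-- The end coordinate is continuous on the end. [folklore] -/
theorem continuousOn_endCoordT (K : D.End) : ContinuousOn (D.endCoordT K) (K : Set T) := by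
  rw [continuousOn_iff_continuous_restrict]
  have h : Continuous fun k : (K : Set T) ↦ ((K.root k : ℂ))⁻¹ :=
    (continuous_subtype_val.comp K.root.continuous).inv₀ fun k ↦ K.root_ne_zero k
  convert h using 1
  funext k
  exact D.endCoordT_of_mem K k.2

/-- The end coordinate is continuous at the old points of the end. [folklore] -/
theorem continuousAt_endCoord_inl (K : D.End) {t : T} (ht : t ∈ (K : Set T)) : ContinuousAt (D.endCoord K) (D.inl t) := by
  rw [← D.isOpenEmbedding_inl.continuousAt_iff]
  exact (D.continuousOn_endCoordT K).continuousAt (K.isOpen.mem_nhds ht)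

/-- **The inverse end coordinate is continuous at `0`** (small discs go to cusp neighbourhoods).
[cite: Forster1981, §8 Thm. 8.4 (proof)] -/
theorem continuousAt_endCoordInv_zero (K : D.End) : ContinuousAt (D.endCoordInv K) 0 := by
  rw [ContinuousAt, endCoordInv_zero, (D.nhds_infty_hasBasis K).tendsto_right_iff]
  intro r _
  set r' : ℝ := max r 1 with hr'
  have hr'pos : 0 < r' := lt_of_lt_of_le one_pos (le_max_right _ _)
  set δ : ℝ := min K.rho ((r' ^ (1 / (K.degree : ℝ)))⁻¹) with hδ
  have hδpos : 0 < δ := lt_min K.rho_pos (inv_pos.2 (Real.rpow_pos_of_pos hr'pos _))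
  filter_upwards [Metric.ball_mem_nhds (0 : ℂ) hδpos] with z hz
  rw [Metric.mem_ball, dist_zero_right] at hz
  by_cases hz0 : z = 0
  · rw [hz0, endCoordInv_zero]; exact D.infty_mem_cuspNhd K r
  · have hzρ : ‖z‖ < K.rho := hz.trans_le (min_le_left _ _)
    rw [D.endCoordInv_of_ne K hz0 hzρ, inl_mem_cuspNhd_iff]
    refine ⟨(K.root.symm _).2, lt_of_le_of_lt (le_max_left r 1) ?_⟩
    -- `|F| = |z|^{-e} > r'`
    have hF : ‖D.F (K.root.symm ⟨z⁻¹, K.inv_mem_extDisc hz0 hzρ⟩ : T)‖ = ‖z‖⁻¹ ^ K.degree := by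
      rw [← K.norm_root_pow, Homeomorph.apply_symm_apply, norm_inv]
    rw [hF]
    have hzlt : ‖z‖ < (r' ^ (1 / (K.degree : ℝ)))⁻¹ := hz.trans_le (min_le_right _ _)
    have hinv : r' ^ (1 / (K.degree : ℝ)) < ‖z‖⁻¹ := by
      rwa [lt_inv_comm₀ (Real.rpow_pos_of_pos hr'pos _) (norm_pos_iff.2 hz0)]
    calc r' = (r' ^ (1 / (K.degree : ℝ))) ^ K.degree := by
          rw [one_div, Real.rpow_inv_natCast_pow hr'pos.le K.degree_pos.ne']
      _ < ‖z‖⁻¹ ^ K.degree := pow_lt_pow_left₀ hinv (Real.rpow_nonneg hr'pos.le _) K.degree_pos.ne'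

/-- **The inverse end coordinate is continuous on the punctured chart disc.** [folklore] -/
theorem continuousOn_endCoordInv (K : D.End) : ContinuousOn (D.endCoordInv K) (Metric.ball 0 K.rho \ {0}) := by
  set s : Set ℂ := Metric.ball 0 K.rho \ {0} with hs
  have hmem : ∀ z : s, (z : ℂ)⁻¹ ∈ extDisc (D.R ^ (1 / (K.degree : ℝ))) := fun z ↦
    K.inv_mem_extDisc z.2.2 (by simpa [Metric.mem_ball, dist_zero_right] using z.2.1)
  have hlift : Continuous fun z : s ↦ (⟨(z : ℂ)⁻¹, hmem z⟩ : extDisc (D.R ^ (1 / (K.degree : ℝ)))) :=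
    ((continuous_subtype_val.inv₀ fun z ↦ z.2.2)).subtype_mk _
  rw [continuousOn_iff_continuous_restrict]
  have h : Continuous fun z : s ↦ D.inl (K.root.symm ⟨(z : ℂ)⁻¹, hmem z⟩ : (K : Set T)) :=
    D.continuous_inl.comp (continuous_subtype_val.comp (K.root.symm.continuous.comp hlift))
  convert h using 1
  funext z
  exact D.endCoordInv_of_ne K z.2.2 (by simpa [Metric.mem_ball, dist_zero_right] using z.2.1)

/-- **The end chart `ζ_K : {∞_K} ∪ K → {|z| < ρ_K}`** as an open partial homeomorphism of `T̄`.
[cite: Forster1981, §8 Thm. 8.4 (proof)] -/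
def endChart (K : D.End) : OpenPartialHomeomorph D.Cpt ℂ where
  toFun := D.endCoord K
  invFun := D.endCoordInv K
  source := D.cuspNhd K 0
  target := Metric.ball 0 K.rho
  map_source' := by
    intro x hx
    rcases D.inl_or_infty x with ⟨t, rfl⟩ | ⟨K', rfl⟩
    · rw [inl_mem_cuspNhd_iff] at hx
      rw [Metric.mem_ball, dist_zero_right, D.endCoord_inl_of_mem K hx.1]
      exact K.norm_root_inv_lt _
    · rw [Metric.mem_ball, dist_zero_right, endCoord_infty, norm_zero]
      exact K.rho_pos
  map_target' := by
    intro z hz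
    rw [Metric.mem_ball, dist_zero_right] at hz
    by_cases hz0 : z = 0
    · rw [hz0, endCoordInv_zero]; exact D.infty_mem_cuspNhd K 0
    · rw [D.endCoordInv_of_ne K hz0 hz, inl_mem_cuspNhd_iff]
      exact ⟨(K.root.symm _).2, D.R_pos.trans (K.subset_total (K.root.symm _).2)⟩
  left_inv' := by
    intro x hx
    rcases D.inl_or_infty x with ⟨t, rfl⟩ | ⟨K', rfl⟩
    · rw [inl_mem_cuspNhd_iff] at hx
      exact D.endCoordInv_endCoord_inl K hx.1
    · rw [infty_mem_cuspNhd_iff] at hx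
      subst hx
      rw [endCoord_infty, endCoordInv_zero]
  right_inv' := by
    intro z hz
    rw [Metric.mem_ball, dist_zero_right] at hz
    exact D.endCoord_endCoordInv K hz
  open_source := D.isOpen_cuspNhd K 0
  open_target := Metric.isOpen_ball
  continuousOn_toFun := by
    refine (D.isOpen_cuspNhd K 0).continuousOn_iff.2 fun x hx ↦ ?_
    rcases D.inl_or_infty x with ⟨t, rfl⟩ | ⟨K', rfl⟩
    · rw [inl_mem_cuspNhd_iff] at hx
      exact D.continuousAt_endCoord_inl K hx.1
    · rw [infty_mem_cuspNhd_iff] at hx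
      rw [hx]
      exact D.continuousAt_endCoord_infty K
  continuousOn_invFun := by
    refine Metric.isOpen_ball.continuousOn_iff.2 fun z hz ↦ ?_
    by_cases hz0 : z = 0
    · subst hz0
      exact D.continuousAt_endCoordInv_zero K
    · exact (D.continuousOn_endCoordInv K).continuousAt ((Metric.isOpen_ball.sdiff isClosed_singleton).mem_nhds ⟨hz, hz0⟩)

/-- The end chart as a function (definitional). [folklore] -/
@[simp] theorem coe_endChart (K : D.End) : ⇑(D.endChart K) = D.endCoord K := rfl

/-- The inverse of the end chart as a function (definitional). [folklore] -/
@[simp] theorem coe_endChart_symm (K : D.End) : ⇑(D.endChart K).symm = D.endCoordInv K := rfl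

/-- The source of the end chart (definitional). [folklore] -/
@[simp] theorem endChart_source (K : D.End) : (D.endChart K).source = D.cuspNhd K 0 := rfl

/-- The target of the end chart (definitional). [folklore] -/
@[simp] theorem endChart_target (K : D.End) : (D.endChart K).target = Metric.ball 0 K.rho := rfl

/-- `∞_K` lies in the source of its chart. [folklore] -/
theorem infty_mem_endChart_source (K : D.End) : D.infty K ∈ (D.endChart K).source := D.infty_mem_cuspNhd K 0

/-- The old points of the end lie in the source of the end chart. [folklore] -/
theorem inl_mem_endChart_source (K : D.End) {t : T} (ht : t ∈ (K : Set T)) : D.inl t ∈ (D.endChart K).source := by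
  rw [endChart_source, inl_mem_cuspNhd_iff]
  exact ⟨ht, D.R_pos.trans (K.subset_total ht)⟩

/-- The source of the end chart consists of `∞_K` and the end. [folklore] -/
theorem mem_endChart_source_iff (K : D.End) {x : D.Cpt} :
    x ∈ (D.endChart K).source ↔ x = D.infty K ∨ ∃ t ∈ (K : Set T), x = D.inl t := by
  rcases D.inl_or_infty x with ⟨t, rfl⟩ | ⟨K', rfl⟩
  · rw [endChart_source, inl_mem_cuspNhd_iff]
    constructor
    · exact fun h ↦ Or.inr ⟨t, h.1, rfl⟩
    · rintro (h | ⟨t', ht', h⟩)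
      · exact absurd h (D.inl_ne_infty t K)
      · rw [D.inl_injective h]; exact ⟨ht', D.R_pos.trans (K.subset_total ht')⟩
  · rw [endChart_source, infty_mem_cuspNhd_iff]
    constructor
    · rintro rfl; exact Or.inl rfl
    · rintro (h | ⟨t, -, h⟩)
      · exact D.infty_injective h
      · exact absurd h.symm (D.inl_ne_infty t K')

/-- The end chart vanishes at `∞_K`. [folklore] -/
theorem endChart_infty (K : D.End) : D.endChart K (D.infty K) = 0 := rfl

/-! ### The compactification is compact -/

/-- **`T̄` is compact**: it is the union of `inl(F⁻¹{|z| ≤ R + 1})` (compact: `F` is proper) and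
the closed cusp discs `ζ_K⁻¹{|z| ≤ (R+1)^{-1/e_K}}`. [cite: Forster1981, §8 Thm. 8.4 (proof)] -/
instance instCompactSpace : CompactSpace D.Cpt := by
  refine ⟨?_⟩
  set ρ' : D.End → ℝ := fun K ↦ ((D.R + 1) ^ (1 / (K.degree : ℝ)))⁻¹ with hρ'
  have hR1 : 0 < D.R + 1 := by linarith [D.R_pos]
  have hρ'lt : ∀ K, ρ' K < K.rho := fun K ↦ by
    rw [hρ', End.rho]
    refine (inv_lt_inv₀ (Real.rpow_pos_of_pos hR1 _) K.rpow_pos).2 ?_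
    exact Real.rpow_lt_rpow D.R_pos.le (lt_add_one _) (one_div_pos.2 K.degree_pos_real)
  have hcov : (univ : Set D.Cpt) ⊆ D.inl '' (D.F ⁻¹' Metric.closedBall 0 (D.R + 1)) ∪
      ⋃ K, (D.endChart K).symm '' Metric.closedBall 0 (ρ' K) := by
    intro x _
    rcases D.inl_or_infty x with ⟨t, rfl⟩ | ⟨K, rfl⟩
    · by_cases ht : ‖D.F t‖ ≤ D.R + 1
      · exact Or.inl ⟨t, by simpa using ht, rfl⟩
      · rw [not_le] at ht
        have htot : t ∈ D.total := lt_trans (lt_add_one _) ht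
        set K := D.endOf htot
        have htK : t ∈ (K : Set T) := D.mem_endOf htot
        refine Or.inr (mem_iUnion.2 ⟨K, D.endChart K (D.inl t), ?_, (D.endChart K).left_inv (D.inl_mem_endChart_source K htK)⟩)
        rw [Metric.mem_closedBall, dist_zero_right, coe_endChart, D.norm_endCoord_inl K htK, hρ']
        simp only
        rw [Real.rpow_neg (norm_nonneg _)]
        refine (inv_lt_inv₀ (Real.rpow_pos_of_pos (hR1.trans ht) _) (Real.rpow_pos_of_pos hR1 _)).2 ?_ |>.le
        exact Real.rpow_lt_rpow hR1.le ht (one_div_pos.2 K.degree_pos_real)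
    · refine Or.inr (mem_iUnion.2 ⟨K, 0, ?_, ?_⟩)
      · rw [Metric.mem_closedBall, dist_zero_right, norm_zero]
        exact (inv_pos.2 (Real.rpow_pos_of_pos hR1 _)).le
      · rw [coe_endChart_symm, endCoordInv_zero]
  refine IsCompact.of_isClosed_subset (IsCompact.union ?_ (isCompact_iUnion fun K ↦ ?_)) isClosed_univ hcov
  · exact ((D.proper.isCompact_preimage (isCompact_closedBall 0 _)).image D.continuous_inl)
  · refine (isCompact_closedBall 0 _).image_of_continuousOn ((D.endChart K).continuousOn_symm.mono ?_)
    rw [endChart_target]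
    exact Metric.closedBall_subset_ball (hρ'lt K)

/-- **Every point of `T̄` is old or in the source of an end chart.** [folklore] -/
theorem mem_range_inl_or_mem_endChart_source (x : D.Cpt) : x ∈ range D.inl ∨ ∃ K, x ∈ (D.endChart K).source := by
  rcases D.inl_or_infty x with ⟨t, rfl⟩ | ⟨K, rfl⟩
  · exact Or.inl ⟨t, rfl⟩
  · exact Or.inr ⟨K, D.infty_mem_endChart_source K⟩

end EndsDatum

end RiemannSurface

end Literature.Geometry.Kaehler
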